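import Mathlib
import Summits.Ventures.PercRepro2.K5Typed
import Summits.Ventures.PercRepro2.HCovTyped
import Summits.Ventures.PercRepro2.K5K3Kernel

/-!
# THE TWELVE FUNCTIONS OF `K₃` ON `K₅` ARE THE TABLES OF `K5K3Kernel.lean`
(blind cell PercRepro2, typer-1 g10; lead g26 03:29:09Z «K5TypedK3», p2's subtraction 03:22:27Z)

On `K₅` with the marks `(o, a₁, a₂, a₃, b) = (0, 1, 2, 3, b)` the twelve functions of p1's kernel `K₃`
(`HCovFns.lean`) are differences of the `0/1` tables of `K5K3Kernel.lean`: `1_{v∈C₁}`, `1_{v∈C₂}`, `1_Q`, `1_PD`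
are the tables `tL v`, `tH v`, `tQ`, `tPD` (`iL_eq`, …, `iPD_eq3`, through `K5Conn.conn_iff`), and on `Q` no
vertex lies in both clusters (`conn12_of`), so each `f_i` is `f_i⁺ − f_i⁻` (`f3_eq`, …, `f12_eq`: Boolean
identities `f3_bool`, …, `f12_bool` checked by cases).  Hence **`K3_apply`**: `K₃ x y w` is the signed sum of
the twenty products of tables of `kPos3` / `kNeg3`, in the order `x, y, w`.  `K5TypedK3.lean` turns this
into the typed-count identity and the kernel theorem.
-/

namespace Summit.Ventures.PercRepro2

open Hub

namespace K5

/-! ## The twelve functions as tables -/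

section Tables

variable {R : Type*} [Field R]

/-- `L_v` is the event `{v ∈ C₁}`. -/
lemma tL_iff (v : Fin 5) (ω : Fin 10 → Bool) : tL v ω = true ↔ ω ∈ connEvent ends5 1 v :=
  conn_iff_mem ω (by norm_num) v.isLt

/-- `H_v` is the event `{v ∈ C₂}`. -/
lemma tH_iff (v : Fin 5) (ω : Fin 10 → Bool) : tH v ω = true ↔ ω ∈ connEvent ends5 2 v :=
  conn_iff_mem ω (by norm_num) v.isLt

/-- `1_{v∈C₁}` is the table `L_v`. -/
lemma iL_eq (v : Fin 5) : (CovForm.iL ends5 1 v : Config (Fin 10) → R) = indR (tL v) :=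
  indicator_eq_indR _ _ (tL_iff v)

/-- `1_{v∈C₂}` is the table `H_v`. -/
lemma iH_eq (v : Fin 5) : (CovForm.iH ends5 2 v : Config (Fin 10) → R) = indR (tH v) :=
  indicator_eq_indR _ _ (tH_iff v)

/-- `1_Q` is the table `tQ`. -/
lemma iQ_eq3 : (CovForm.iQ ends5 1 2 : Config (Fin 10) → R) = indR tQ :=
  indicator_eq_indR _ _ tQ_iff

/-- `1_PD` is the table `tPD`. -/
lemma iPD_eq3 : (CovForm.iPD ends5 1 2 3 : Config (Fin 10) → R) = indR tPD :=
  indicator_eq_indR _ _ tPD_iff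

/-- `((3 : Fin 5) : ℕ) = 3`. -/
lemma val3 : ((3 : Fin 5) : ℕ) = 3 := rfl

/-- **On `Q` no vertex lies in both clusters**: `v ∈ C₁` and `v ∈ C₂` force `a₁ ↔ a₂`. -/
lemma conn12_of (ω : Fin 10 → Bool) (v : Fin 5) (hL : conn ω 1 v = true) (hH : conn ω 2 v = true) :
    conn ω 1 2 = true := by
  have h1 : Conn ends5 ω 1 v := (conn_iff ω 1 v).1 hL
  have h2 : Conn ends5 ω 2 v := (conn_iff ω 2 v).1 hH
  exact (conn_iff ω 1 2).2 (conn_trans h1 (conn_symm h2))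

/-- Boolean form of `f₃ = 1_PD 1_{o∈U}`. -/
lemma f3_bool (c12 c13 c23 c10 c20 : Bool) (e0 : c10 = true → c20 = true → c12 = true) :
    (if (!c12 && !c13 && !c23) = true then (1 : R) else 0) *
      ((if c10 = true then 1 else 0) + (if c20 = true then 1 else 0)) =
      if (!c12 && !c13 && !c23 && (c10 || c20)) = true then 1 else 0 := by
  cases c12 <;> cases c13 <;> cases c23 <;> cases c10 <;> cases c20 <;> simp_all

/-- `f₃ = 1_PD 1_{o∈U}` is the table `tPDoU`. -/
lemma f3_eq : (CovForm.f3 ends5 0 1 2 3 : Config (Fin 10) → R) = indR tPDoU := by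
  funext ω
  unfold CovForm.f3 CovForm.inU
  rw [iPD_eq3, iL_eq, iH_eq]
  unfold indR tPDoU tPD tQ tL tH
  exact f3_bool _ _ _ _ _ (conn12_of ω 0)

/-- Boolean form of `1_Q σ_u σ_v` (`f₄` at `u = o`, `f₅` at `u = a₃`). -/
lemma f4_bool (c12 c1u c2u c1v c2v : Bool) (eu : c1u = true → c2u = true → c12 = true)
    (ev : c1v = true → c2v = true → c12 = true) :
    (if (!c12) = true then (1 : R) else 0) *
      (((if c1u = true then 1 else 0) - (if c2u = true then 1 else 0)) *
        ((if c1v = true then 1 else 0) - (if c2v = true then 1 else 0))) =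
      (if (!c12 && ((c1u && c1v) || (c2u && c2v))) = true then 1 else 0) -
        (if (!c12 && ((c1u && c2v) || (c2u && c1v))) = true then 1 else 0) := by
  cases c12 <;> cases c1u <;> cases c2u <;> cases c1v <;> cases c2v <;> simp_all

/-- `f₄ = 1_Q σ_o σ_b` is `t4p − t4m`. -/
lemma f4_eq (b : Fin 5) :
    (CovForm.f4 ends5 0 1 2 b : Config (Fin 10) → R) = fun ω => indR (t4p b) ω - indR (t4m b) ω := by
  funext ω
  unfold CovForm.f4 CovForm.sigma
  rw [iQ_eq3, iL_eq, iH_eq, iL_eq, iH_eq]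
  unfold indR t4p t4m tSame tOpp tQ tL tH
  exact f4_bool _ _ _ _ _ (conn12_of ω 0) (conn12_of ω b)

/-- `f₅ = 1_Q σ₃ σ_b` is `t5p − t5m`. -/
lemma f5_eq (b : Fin 5) :
    (CovForm.f5 ends5 1 2 3 b : Config (Fin 10) → R) = fun ω => indR (t5p b) ω - indR (t5m b) ω := by
  funext ω
  unfold CovForm.f5 CovForm.sigma
  rw [iQ_eq3, iL_eq, iH_eq, iL_eq, iH_eq]
  unfold indR t5p t5m tSame tOpp tQ tL tH
  exact f4_bool _ _ _ _ _ (conn12_of ω 3) (conn12_of ω b)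

/-- Boolean form of `f₆ = 1_Q σ₃ 1_{o∈U} σ_b`. -/
lemma f6_bool (c12 c13 c23 c10 c20 c1b c2b : Bool) (e3 : c13 = true → c23 = true → c12 = true)
    (e0 : c10 = true → c20 = true → c12 = true) (eb : c1b = true → c2b = true → c12 = true) :
    (if (!c12) = true then (1 : R) else 0) *
      (((if c13 = true then 1 else 0) - (if c23 = true then 1 else 0)) *
        (((if c10 = true then 1 else 0) + (if c20 = true then 1 else 0)) *
          ((if c1b = true then 1 else 0) - (if c2b = true then 1 else 0)))) =
      (if (!c12 && (c10 || c20) && ((c13 && c1b) || (c23 && c2b))) = true then 1 else 0) -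
        (if (!c12 && (c10 || c20) && ((c13 && c2b) || (c23 && c1b))) = true then 1 else 0) := by
  cases c12 <;> cases c13 <;> cases c23 <;> cases c10 <;> cases c20 <;> cases c1b <;> cases c2b <;>
    simp_all

/-- `f₆ = 1_Q σ₃ 1_{o∈U} σ_b` is `t6p − t6m`. -/
lemma f6_eq (b : Fin 5) :
    (CovForm.f6 ends5 0 1 2 3 b : Config (Fin 10) → R) = fun ω => indR (t6p b) ω - indR (t6m b) ω := by
  funext ω
  unfold CovForm.f6 CovForm.sigma CovForm.inU
  rw [iQ_eq3, iL_eq, iH_eq, iL_eq, iH_eq, iL_eq, iH_eq]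
  unfold indR t6p t6m tSame tOpp tU tQ tL tH
  exact f6_bool _ _ _ _ _ _ _ (conn12_of ω 3) (conn12_of ω 0) (conn12_of ω b)

/-- Boolean form of `f₇ = 1_Q σ_v`. -/
lemma f7_bool (c12 c1v c2v : Bool) (ev : c1v = true → c2v = true → c12 = true) :
    (if (!c12) = true then (1 : R) else 0) *
      ((if c1v = true then 1 else 0) - (if c2v = true then 1 else 0)) =
      (if (!c12 && c1v) = true then 1 else 0) - (if (!c12 && c2v) = true then 1 else 0) := by
  cases c12 <;> cases c1v <;> cases c2v <;> simp_all

/-- `f₇ = 1_Q σ_v` is `t7p v − t7m v`. -/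
lemma f7_eq (v : Fin 5) :
    (CovForm.f7 ends5 1 2 v : Config (Fin 10) → R) = fun ω => indR (t7p v) ω - indR (t7m v) ω := by
  funext ω
  unfold CovForm.f7 CovForm.sigma
  rw [iQ_eq3, iL_eq, iH_eq]
  unfold indR t7p t7m tQ tL tH
  exact f7_bool _ _ _ (conn12_of ω v)

/-- Boolean form of `f₁₀ = 1_Q σ₃ 1_{o∈U}`. -/
lemma f10_bool (c12 c13 c23 c10 c20 : Bool) (e3 : c13 = true → c23 = true → c12 = true)
    (e0 : c10 = true → c20 = true → c12 = true) :
    (if (!c12) = true then (1 : R) else 0) *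
      (((if c13 = true then 1 else 0) - (if c23 = true then 1 else 0)) *
        ((if c10 = true then 1 else 0) + (if c20 = true then 1 else 0))) =
      (if (!c12 && c13 && (c10 || c20)) = true then 1 else 0) -
        (if (!c12 && c23 && (c10 || c20)) = true then 1 else 0) := by
  cases c12 <;> cases c13 <;> cases c23 <;> cases c10 <;> cases c20 <;> simp_all

/-- `f₁₀ = 1_Q σ₃ 1_{o∈U}` is `t10p − t10m`. -/
lemma f10_eq : (CovForm.f10 ends5 0 1 2 3 : Config (Fin 10) → R) = fun ω => indR t10p ω - indR t10m ω := by
  funext ω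
  unfold CovForm.f10 CovForm.sigma CovForm.inU
  rw [iQ_eq3, iL_eq, iH_eq, iL_eq, iH_eq]
  unfold indR t10p t10m tU tQ tL tH
  exact f10_bool _ _ _ _ _ (conn12_of ω 3) (conn12_of ω 0)

/-- Boolean form of `f₁₁ = 1_PD 1_{o∈U} 1_{b∈U}`. -/
lemma f11_bool (c12 c13 c23 c10 c20 c1b c2b : Bool) (e0 : c10 = true → c20 = true → c12 = true)
    (eb : c1b = true → c2b = true → c12 = true) :
    (if (!c12 && !c13 && !c23) = true then (1 : R) else 0) *
      (((if c10 = true then 1 else 0) + (if c20 = true then 1 else 0)) *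
        ((if c1b = true then 1 else 0) + (if c2b = true then 1 else 0))) =
      if (!c12 && !c13 && !c23 && (c10 || c20) && (c1b || c2b)) = true then 1 else 0 := by
  cases c12 <;> cases c13 <;> cases c23 <;> cases c10 <;> cases c20 <;> cases c1b <;> cases c2b <;>
    simp_all

/-- `f₁₁ = 1_PD 1_{o∈U} 1_{b∈U}` is the table `t11`. -/
lemma f11_eq (b : Fin 5) : (CovForm.f11 ends5 0 1 2 3 b : Config (Fin 10) → R) = indR (t11 b) := by
  funext ω
  unfold CovForm.f11 CovForm.inU
  rw [iPD_eq3, iL_eq, iH_eq, iL_eq, iH_eq]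
  unfold indR t11 tU tPD tQ tL tH
  exact f11_bool _ _ _ _ _ _ _ (conn12_of ω 0) (conn12_of ω b)

/-- Boolean form of `f₁₂ = 1_PD 1_{b∈U}`. -/
lemma f12_bool (c12 c13 c23 c1b c2b : Bool) (eb : c1b = true → c2b = true → c12 = true) :
    (if (!c12 && !c13 && !c23) = true then (1 : R) else 0) *
      ((if c1b = true then 1 else 0) + (if c2b = true then 1 else 0)) =
      if (!c12 && !c13 && !c23 && (c1b || c2b)) = true then 1 else 0 := by
  cases c12 <;> cases c13 <;> cases c23 <;> cases c1b <;> cases c2b <;> simp_all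

/-- `f₁₂ = 1_PD 1_{b∈U}` is the table `t12`. -/
lemma f12_eq (b : Fin 5) : (CovForm.f12 ends5 1 2 3 b : Config (Fin 10) → R) = indR (t12 b) := by
  funext ω
  unfold CovForm.f12 CovForm.inU
  rw [iPD_eq3, iL_eq, iH_eq]
  unfold indR t12 tU tPD tQ tL tH
  exact f12_bool _ _ _ _ _ (conn12_of ω b)

/-- **The kernel `K₃` on `K₅` is the signed sum of twenty products of tables** (the ten positive
products of `kPos3`, then the ten negative products of `kNeg3`, in the order `x, y, w`). -/
lemma K3_apply (b : Fin 5) (x y w : Config (Fin 10)) :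
    CovForm.K3 (R := R) ends5 0 1 2 3 b x y w =
      (indR tPD x * indR tQ y * indR (t4p b) w + indR tQ x * indR tPDoU y * indR (t5p b) w +
        indR tPD x * indR tQ y * indR (t6m b) w +
        indR tPD x * indR (t7p b) y * indR (t7m 0) w + indR tPD x * indR (t7m b) y * indR (t7p 0) w +
        indR tPDoU x * indR (t7p b) y * indR (t7m 3) w + indR tPDoU x * indR (t7m b) y * indR (t7p 3) w +
        indR tPD x * indR (t7p b) y * indR t10p w + indR tPD x * indR (t7m b) y * indR t10m w +
        indR tQ x * indR (t12 b) y * indR tPDoU w) -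
      (indR tPD x * indR tQ y * indR (t4m b) w + indR tQ x * indR tPDoU y * indR (t5m b) w +
        indR tPD x * indR tQ y * indR (t6p b) w +
        indR tPD x * indR (t7p b) y * indR (t7p 0) w + indR tPD x * indR (t7m b) y * indR (t7m 0) w +
        indR tPDoU x * indR (t7p b) y * indR (t7p 3) w + indR tPDoU x * indR (t7m b) y * indR (t7m 3) w +
        indR tPD x * indR (t7p b) y * indR t10m w + indR tPD x * indR (t7m b) y * indR t10p w +
        indR tPD x * indR tQ y * indR (t11 b) w) := by
  unfold CovForm.K3 CovForm.sepKernel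
  simp only [Fin.sum_univ_succ, Fin.sum_univ_zero, Matrix.cons_val_zero, Matrix.cons_val_succ,
    add_zero]
  rw [iPD_eq3, iQ_eq3, f3_eq, f4_eq, f5_eq, f6_eq, f7_eq, f7_eq, f7_eq, f10_eq, f11_eq, f12_eq]
  simp only [val3, Fin.val_zero]
  ring

end Tables

end K5

end Summit.Ventures.PercRepro2
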